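import Summits.BirchSwinnertonDyer.BirchSwinnertonDyer.Theorems.ErratumRoadFiveNonSurjCornerLowerHalfNonSurjDoorsContra
import Summits.BirchSwinnertonDyer.BirchSwinnertonDyer.Theorems.PrintX11aUpperNonSurjThreeCorollary18OfMazur
import HarnessLib

/-!
# Route `ErratumRoadFive` (rung K2), crux `NonSurjCorner` (item stmt-BirchSwinnertonDyer-19065), registered line `Lines/hybrid.lean`:
# THE NON-SURJECTIVE HIDA DOORS WITHOUT GREENBERG 1999 Thm. 1.5 AND WITHOUT WUTHRICH 2014 Cor. 18 — `_of_mazur` siblings of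
# `…LowerHalfNonSurjDoorsContra` (the `h₄ℓ` producer of glues #11 ∕ #12), for the slot-3 shrink of the line (glue #13, r11)
# (cell `bsd-stepL`, seat `bsd-stepL-corner-p1` g17; `--supports stmt-BirchSwinnertonDyer-19065 --as helper`)

WHY THIS FILE. In the doors of `…LowerHalfNonSurjDoorsContra` (this seat g16, p619004) the named facts Greenberg 1999 Thm. 1.5 (`h15`,
conjunct 21 of slot 3) and Wuthrich 2014 Cor. 18 (`h18`, conjunct 22) enter at ONE point only: the typed divisibility
`X11b.multDivisibilityAt_of_katoFacts_of_muAnZeroAt_contra`. Cell `bsd-print-x11a` (bsd-line-x11a-p2 g3, p621238,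
`…PrintX11aUpperNonSurjThreeCorollary18OfMazur`) proved that on a pair with `E[p]` irreducible both are REDUNDANT given Mazur 1978
Cor. 4.1 (conjunct 9, `mazur_not_dvd_maninConstant_of_odd`, which the same chain already consumes): Cor. 18 AT THE PAIR is
`X11b.corollary18At_of_irr_of_mazur`, and `Λ`-torsion comes with bsd-2adic's VII′ — `X11b.multDivisibilityAt_of_katoFacts_of_muAnZeroAt_contra_of_mazur`.
THIS FILE threads that theorem through the two doors, token for token:
* `ClassX11a.missingLowerBoundAt_of_muAnZeroAt_of_not_surj_of_contraFacts_of_mazur` — the per-pair door with `(h15, h18) ↦ hMz`;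
* `NonSurjChain.lowerNonSurj_fiveSeven_of_nonSurjCornerTwinMuAn_of_contraFacts_of_mazur` — the class-level form read off item 19948's body
  (`Theorems.NonSurjCornerTwinMuAn`), likewise; this is the `h₄ℓ` producer of glue #13 (slot 3 shrunk 23 → 16 conjuncts).
Also `Kato2004.nonempty_iwasawaH1Data` (conjunct 17) is taken from the tree theorem `Kato2004.nonempty_iwasawaH1Data_holds`, as p619004
already did. The γ-keyed and the 23-fact `_contraFacts` doors are untouched.

HONEST FRAMING: THEOREMS ONLY (no definition, no named fact, no `sorry`); CONDITIONAL on the displayed named facts (V′ ∕ VI′ ∕ XI′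
CONSTRUCTION facts, print-exact per ARM-P; EPW 2006 ×3, Wan 2015 Thm 4 (irred; typer's flag), Deligne–Serre, Hida, Kato 12.4, Mazur Cor. 4.1,
Stein–Wuthrich 6.1 ×2, GZK, Greenberg–Stevens, modularity); PER PAIR the certificate `μ^an = 0` is decidable, class-wide it is Greenberg's
conjecture; nothing is discharged; 19065 ∕ 19948 stay OPEN; nothing about any curve's BSD; BSD is not advanced; T7. Credit: bsd-line-x11a-p2 g3
(Cor. 18 from Mazur, the `_of_mazur` chain), bsd-line-er5-p2 (the doors), bsd-2adic tower-1 g19 (VII′), defn-ty1 g18 (V′ ∕ VI′ ∕ XI′).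
References (locators only): [cite: Mazur1978, Cor. 4.1] [cite: Wuthrich2014, Cor. 18 (p. 398)] [cite: EmertonPollackWeston2006, Thm. 3.1.1, Thm. 1, Thm. 5.1.3]
[cite: Wan2015, Thm. 4] [cite: Kato2004Asterisque, Thm. 12.4, §17.13] [cite: SteinWuthrich2013, Thm. 6.1] [cite: Miller2011LMS, §1 and Def. 1.1]
[cite: GreenbergLNM1716, Conj. 1.11 (shape)].
-/

set_option autoImplicit false
set_option linter.dupNamespace false

noncomputable section

open scoped Classical MatrixGroups ModularForm

open CongruenceSubgroup WeierstrassCurve Literature.NumberTheory.EllipticCurves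
  Literature.NumberTheory.EllipticCurves.ModularForms
  Literature.NumberTheory.EllipticCurves.Rank1Residual
  Literature.NumberTheory.EllipticCurves.Rank1Residual.Typed
  Literature.NumberTheory.EllipticCurves.Wuthrich2014
  Literature.NumberTheory.EllipticCurves.SteinWuthrich2013
  Literature.NumberTheory.EllipticCurves.Kato2004
  Literature.NumberTheory.EllipticCurves.GreenbergVatsal2000
  Literature.NumberTheory.EllipticCurves.EmertonPollackWeston2006
  Literature.NumberTheory.EllipticCurves.BalakrishnanEtAl2019
  Literature.NumberTheory.GaloisRepresentations
  Summit.BirchSwinnertonDyer.Rank1Residual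
  Summit.BirchSwinnertonDyer.Rank1Residual.X1.MuLambda
  Summit.BirchSwinnertonDyer.Rank1Residual.X11a
  Summit.BirchSwinnertonDyer.Rank1Residual.X11a.LambdaNorm
  Summit.BirchSwinnertonDyer.Rank1Residual.X11a.Chain

namespace Summit.BirchSwinnertonDyer.BirchSwinnertonDyer.Theorems.NonSurjChain

section Doors

variable {W : WeierstrassCurve ℚ} [W.IsElliptic] [W.IsGloballyMinimal] {p : ℕ} [Fact p.Prime]

/-- **THE LOWER HALF at a NON-surjective X11a pair, `p ≥ 5`, from the certificate `μ^an(E,p) = 0` ALONE, on the PRINT-EXACT contragredient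
Kato packages, WITHOUT Greenberg 1999 Thm. 1.5 and WITHOUT Wuthrich 2014 Cor. 18** — `ClassX11a.missingLowerBoundAt_of_muAnZeroAt_of_not_surj_of_contraFacts`
(p619004) with its typed divisibility produced by x11a-p2's `X11b.multDivisibilityAt_of_katoFacts_of_muAnZeroAt_contra_of_mazur` (Cor. 18 AT THE
PAIR from irreducibility + Mazur Cor. 4.1; `Λ`-torsion from VII′); `𝐇¹_Γ(T_pW)` from `Kato2004.nonempty_iwasawaH1Data_holds`; the divisibility-keyed
chain (invariants match ⟹ Mazur MC ⟹ BSDp ⟹ lower half) VERBATIM. PER PAIR; closes nothing class-wide.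
[cite: Mazur1978, Cor. 4.1] [cite: Miller2011LMS, §1 and Def. 1.1] [cite: EmertonPollackWeston2006, Thm. 5.1.3] [cite: Wan2015, Thm. 4]
[cite: Kato2004Asterisque, §17.13 (pp. 279–280)] [cite: SteinWuthrich2013, Thm. 6.1 (p. 20)] -/
theorem _root_.Summit.BirchSwinnertonDyer.Rank1Residual.ClassX11a.missingLowerBoundAt_of_muAnZeroAt_of_not_surj_of_contraFacts_of_mazur
    (hNf : exists_isNewformOf)
    (h311 : thm311_cotorsion_weightK_member_ofLevel) (hT1a : thm1_muAlg_of_weightK_member_ofLevel)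
    (hT2 : Wan2015.thm4_rational_weightK_member_of_bdd_ofLevel_irred)
    (hT1b : thm513_transfer_from_weightK_member_of_bdd_ofLevel)
    (h61 : DeligneSerre1974.thm61_exists_adicGaloisRep) (h326 : Hida2000_thm326_ordinary)
    (h12 : Kato2004.thm12_4)
    (hns' : Kato2004.exists_multDivisibilityInputs_nonsplit_contra)
    (hsp' : Kato2004.exists_multDivisibilityInputs_split_contra)
    (hfine' : Kato2004.exists_multDivisibilityInputs_fine_contra)
    (hMz : mazur_not_dvd_maninConstant_of_odd)
    (hJs : thm61_splitMultiplicative) (hJn : thm61_nonsplitMultiplicative)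
    (hGZK : rank_eq_analyticRank_of_analyticRank_le_one)
    (hGS : greenberg_stevens (W := W) (p := p))
    (hX : ClassX11a W p) (hnsj : ¬ Surj W p) (hp : 5 ≤ p) (hμ : X11a.MuAnZeroAt W p) :
    MissingLowerBoundAt W p := by
  have hdiv : X11b.MultDivisibilityAt W p :=
    X11b.multDivisibilityAt_of_katoFacts_of_muAnZeroAt_contra_of_mazur Kato2004.nonempty_iwasawaH1Data_holds h12 hNf hns'
      hsp' hfine' hMz W p hX.ne_two hX.mult hX.irr hnsj hμ
  have hMC : X2.MazurMainConjectureAt W p :=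
    mazurMainConjectureAt_of_invariantsMatchAt_of_multDivisibilityAt
      (hasEntireLFunction_rat_of_exists_isNewformOf hNf) W p hGS hdiv hX.analyticRank_eq_zero
      (invariantsMatchAt_of_modularity_ofLevel_of_multDivisibilityAt W p hNf h311 hT1a hT2 hT1b h61 h326
        hp hX.mult hX.irr hdiv hμ)
  have hpar : nonempty_modularParametrizationData :=
    nonempty_modularParametrizationData_of_exists_isNewformOf hNf
      IsNewformOf.exists_maninConstant_ne_zero_holds
  exact hX.missingLowerBoundAt_of_bsdp hGZK
    (bsdp_of_mazurMainConjectureAt_heightFree hJs hJn hGZK (hasEntireLFunction_rat_of_exists_isNewformOf hNf)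
      hpar hGS hX hMC)

end Doors

section ClassLevel

/-- **The lower half on the whole non-surjective X11a locus at `p ∈ {5,7}` from `Theorems.NonSurjCornerTwinMuAn` (item 19948) and the named
facts, on the PRINT-EXACT contragredient Kato packages, WITHOUT Greenberg 1.5 and WITHOUT Wuthrich Cor. 18** —
`lowerNonSurj_fiveSeven_of_nonSurjCornerTwinMuAn_of_contraFacts` (p619004) with `(h15, h18) ↦ hMz`: `p ∣ ord_p Δ_min` is automatic from `¬ Surj`
(`ClassX11a.surj_of_not_dvd`), the certificate is read off 19948's body in the allowable-root currency (`muAnZeroAt_of_allowableRootShape`), then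
the previous door. This is the `h₄ℓ` producer of the hybrid glue #13 of crux 19065 (slot 3 shrunk to sixteen named facts). CONDITIONAL on 19948 +
facts; closes nothing by itself.
[cite: Mazur1978, Cor. 4.1] [cite: GreenbergLNM1716, Conj. 1.11 (shape)] [cite: SilvermanATAEC1994, V.6 Prop. 6.1 (p. 410)]
[cite: EmertonPollackWeston2006, Thm. 5.1.3] [cite: Wan2015, Thm. 4] -/
theorem lowerNonSurj_fiveSeven_of_nonSurjCornerTwinMuAn_of_contraFacts_of_mazur
    (hNf : exists_isNewformOf)
    (h311 : thm311_cotorsion_weightK_member_ofLevel) (hT1a : thm1_muAlg_of_weightK_member_ofLevel)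
    (hT2 : Wan2015.thm4_rational_weightK_member_of_bdd_ofLevel_irred)
    (hT1b : thm513_transfer_from_weightK_member_of_bdd_ofLevel)
    (h61 : DeligneSerre1974.thm61_exists_adicGaloisRep) (h326 : Hida2000_thm326_ordinary)
    (h12 : Kato2004.thm12_4)
    (hns' : Kato2004.exists_multDivisibilityInputs_nonsplit_contra)
    (hsp' : Kato2004.exists_multDivisibilityInputs_split_contra)
    (hfine' : Kato2004.exists_multDivisibilityInputs_fine_contra)
    (hMz : mazur_not_dvd_maninConstant_of_odd)
    (hJs : thm61_splitMultiplicative) (hJn : thm61_nonsplitMultiplicative)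
    (hGZK : rank_eq_analyticRank_of_analyticRank_le_one)
    (hGS : ∀ (W : WeierstrassCurve ℚ) [W.IsElliptic] [W.IsGloballyMinimal] (p : ℕ) [Fact p.Prime],
      greenberg_stevens (W := W) (p := p))
    (h57 : Summit.BirchSwinnertonDyer.BirchSwinnertonDyer.Theorems.NonSurjCornerTwinMuAn) :
    ∀ (W : WeierstrassCurve ℚ) [W.IsElliptic] [W.IsGloballyMinimal] (p : ℕ) [Fact p.Prime],
      ClassX11a W p → ¬ Surj W p → (p = 5 ∨ p = 7) → MissingLowerBoundAt W p := by
  intro W _ _ p _ hX hnsj h57'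
  have hp : 5 ≤ p := by rcases h57' with rfl | rfl <;> omega
  have hdvd : p ∣ padicValInt p W.minimalDiscriminantInt := by
    by_contra hΔ
    exact hnsj (ClassX11a.surj_of_not_dvd W p hX hΔ)
  have hμ : X11a.MuAnZeroAt W p :=
    muAnZeroAt_of_allowableRootShape W p (fun f hf ϖ hϖ a L h1 h2 hL =>
      h57 W p hX hnsj h57' hdvd f hf ϖ hϖ a L h1 h2 hL)
  exact hX.missingLowerBoundAt_of_muAnZeroAt_of_not_surj_of_contraFacts_of_mazur hNf h311 hT1a hT2 hT1b h61 h326 h12 hns'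
    hsp' hfine' hMz hJs hJn hGZK (hGS W p) hnsj hp hμ

end ClassLevel

end Summit.BirchSwinnertonDyer.BirchSwinnertonDyer.Theorems.NonSurjChain

end
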